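import Literature.MathematicalPhysics.QuantumFieldTheory.Balaban1983to89.B6Prop26Census2136KLevelV1
import Literature.MathematicalPhysics.QuantumFieldTheory.Balaban1983to89.B6KLevelCensusBookkeepingV1
import Literature.MathematicalPhysics.QuantumFieldTheory.Balaban1983to89.B6Ineq2140KLevelV1
import HarnessLib

/-!
# `Balaban1983to89.B6Prop26Census2140KLevelV1` — T. Bałaban, *Propagators and renormalization transformations for lattice gauge theories. II*,
Comm. Math. Phys. **96** (1984) 223–250 [Balaban1984PropagatorsII], p. 247 **PROPOSITION 2.6 (2.140): THE SIX `L²` ENTRIES — THE LAST CONJUNCT OF THE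
VERBATIM CENSUS TYPING `…B6.Prop26Printed` — ON THE GENUINE k-LEVEL V1 FAMILY, THE FIRST ENTRY BY NAME AND THE OTHER FIVE MODULO DISPLAYED INPUTS**
(B6-CLOSURE §5 item 21, third file; fold owner r03).

HONEST FRAMING (programme rule): statement-level skeleton of published theorems with citation tags; proofs where landed; nothing here
is a claim about the Yang–Mills mass gap.

PRINT (verbatim, p. 247 [PDF 25]): «‖ζGJ‖, ‖ζ∇GJ‖, ‖ζG∇*J‖, ‖ζ∇G∇*J‖, ‖ζ∇∇GJ‖, ‖ζG∇*∇*J‖ ≤ O(1)[(L^jη)², L^jη, L^jη, 1, 1, 1]|ζ|e^{−δ₃d(y,y′)}‖J‖ (2.140)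
if supp ζ ⊂ Δ(y), y ∈ Λ_j, supp J ⊂ Δ(y′), with the constant O(1) depending on d and L.»  Census reading (`B6.Ineq2136_2140`, last conjunct):
`∀ n J h y y′, cutIn h y → suppIn J y′ → l2 n J h ≤ C·pref6 (len y) n·cutSup h·e^{−δ₃ dist y y′}·l2Norm J`, where on `kGeoG i` (`B6KLevelCensusIndexV1`)
`cutIn h y` = «supp h inside the blocks at torus distance ≤ 1 from y» (print's `Δ̃(y)`), `cutSup h = sup|h|`, `l2Norm J = (Σ_x J(x)²)^{1/2}`, and the
readings `(kG i).l2 n` (`B6Prop26Census2136KLevelV1.kG`) are the flat `ℓ²` norms `l2Of h (·)` of `GJ`, `∇_νGJ`, `G∇*_νJ`, `∇_νG∇*_μJ`, `∇_ν∇_μGJ`,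
`G∇*_ν∇*_μJ` (sups over the directions).

## WHAT THIS FILE CERTIFIES (kernel-checked, sorry-free, standard axioms)

* §1 `l2Of_le_of_sq_le`; **`sum_sq_cutIn_le`** — THE ADJACENT-BLOCK DECOMPOSITION OF THE CUT-OFF: for `supp h ⊂ Δ̃(y)` the sum `Σ_x (h(x)F(x))²`
  splits over the blocks `z` with `d_T(z, y) ≤ 1` into exact-block pieces `Σ_x (h_z(x)F(x))²`, `h_z = h·1_{Δ(z)}`; if each piece is `≤ B` then the whole is
  `≤ e·K·B` with `K` any bound of the radial sum `Σ_z e^{−d_T(y,z)}` (the pieces off `Δ̃(y)` vanish, the others are weighted by `e^{1−d_T(y,z)} ≥ 1`);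
* §2 **`radial_le`** — LEMMA 2.1 (2.61) ON THE V1 TORUS AT RATE ONE: `Σ_z e^{−d_T(y,z)} ≤ K261 N₀ (d+1) L 1 1`, `N₀ = 2(d+1)L`, as soon as `R·L·M_h ≥ N₀ + 1`
  (so that (2.59) `e^{−1}L^{2(d+1)/N₀} = e^{−1}L^{1/L} < 1` holds), by p21's `B6Geom246MultiLevelTorus.lemma21_torus` BY NAME;
* §3 **`l2_entry_le`** — ONE `L²` ENTRY OF THE CENSUS FROM AN EXACT-BLOCK `L²` BOUND: if an operator image `T J` obeys, for `supp ζ ⊂ Δ(z)`, `|ζ| ≤ s`,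
  `supp J ⊂ Δ(y′)`, `Σ_x (ζ(x)(TJ)(x))² ≤ (A·ℓ_z^p·e^{−δd_T(z,y′)}·s)²·Σ_x J(x)²` (`ℓ_z = len_T(z)·|c_f|⁻¹`; the shape of `B6Ineq2140KLevelV1`), then for
  `supp h ⊂ Δ̃(y)`, `supp J ⊂ Δ(y′)`: `l2Of h (TJ) ≤ (√(e·K)·L^p·e^{δ}·A)·(len y)^p·cutSup h·e^{−δ dist(y,y′)}·l2Norm J` (§1 + §2 + the (2.54)/(2.60)
  bookkeeping `B6KLevelCensusBookkeepingV1.adjLen_pow_le`/`exp_adj_le`);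
* §4 **`prop26_census2140_kLevel_of_l2`** — THE LAST CONJUNCT OF `B6.Ineq2136_2140` (all six entries of (2.140)) UNIFORMLY ON THE FAMILY:
  `∃ M₁ δ₃ C > 0, ∀ i, M₁ ≤ M → ∀ n J h y y′, cutIn h y → suppIn J y′ → (kG i).l2 n J h ≤ C·[(Lʲη)², Lʲη, Lʲη, 1, 1, 1]_n·cutSup h·e^{−δ₃ d(y,y′)}·‖J‖`, the
  entry `0` fed BY NAME by p22's `B6Ineq2140KLevelV1.ineq2140_kLevel_unconditional` (`σ := σ₁`, `α := ½`; Schur test on the landed sup entry (2.136)₁), the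
  entries `1 … 5` by FIVE DISPLAYED INPUTS `hl1 … hl5` = the exact-block `L²` bounds of `∇_νGJ`, `G∇*_νJ`, `∇_νG∇*_μJ`, `∇_ν∇_μGJ`, `G∇*_ν∇*_μJ` in the shape of
  entry `0` (`∃ δ A M₂ N₁ …, 0 ≤ s → supp ζ ⊂ Δ(y) → |ζ| ≤ s → supp J ⊂ Δ(y′) → Σ_x (ζ(x)(TJ)(x))² ≤ (A·[ℓ_y]·e^{−δ d_T(y,y′)}·s)²·Σ_x J(x)²` — the TARGET SHAPES for the slot files, literally the output shape of p22's `B6RandomWalkL2.sum_sq_cut_apply_le_of_hasL2Majorant` (block-ℓ² majorant calculus, p380555 ✓); entries 1, 2 follow from the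
  landed sup majorants of `∇_νG`, `G∇*_ν` and their transposes by `B6Ineq2140KLevelV1.sum_sq_cut_apply_le_of_hasMajorant_pair`, entries 3–5 need the sup
  majorants of `∇G∇*`, `∇∇G`, `G∇*∇*`, not in the tree at the time of writing); witnesses: ONE threshold `M₁` = the largest of the six files' `M₂`, `N₁ + 1` and
  `N₀ + 1` (`R ≥ 1`), `δ₃` = the least of the six rates, `C` = the largest of the six constants and `1`.

## HONEST SCOPE

(1) (2.140) ONLY (the last of the five conjuncts of `B6.Prop26Printed`), entries `1 … 5` MODULO the displayed inputs `hl1 … hl5` (hypothesis binders, not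
declarations).  (2) Constants depend on `d, L` AND the band `b₀, b₁` (print: on `d, L`); the rate of entry `0` is `delta3 ½ (2σ₁)/2`.  (3) Readings as documented
in `B6KLevelCensusIndexV1`/`B6Prop26Census2136KLevelV1` (flat `ℓ²` norms: the `η^d`-weights of (2.69) cancel between the two sides of (2.140); `cutIn` = torus
distance `≤ 1`, print's `Δ̃(y)`).  THEOREMS ONLY; no definition, no `def … : Prop` fact.  NOT summit progress.  Unit `lit-balaban-r03` (gen 26),
2026-08-24.
-/

noncomputable section

namespace Literature.MathematicalPhysics.QuantumFieldTheory.Balaban1983to89.B6Prop26Census2140KLevelV1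

open Finset
open LatticeFieldCalculus
open B6SectAOperatorsV1 (BondIdx)
open B6SectAVectorModelV1 (GE)
open B6Ineq2133TwoScaleV1 (onFun)
open B6RandomWalk (delta3 delta3_pos)
open B6MultiLevelBoxOperator (N0)
open B6MultiLevelTorusOperator (TDomains)
open B6GlobalChartV1 (PV domT blkV1)
open B6Geom246MultiLevelTorus (geomT lemma21_torus)
open B8Ineq192MultiLevelTorus (lenT_pos symmT)
open B6Ineq261LevelGap (K261 K261_nonneg)
open B6Prop26KLevelSkeletonV1 (pref)
open B6Prop26KLevelAssemblyV1 (distT_nonneg)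
open B6CubeWindowV1 (Placed GlobalBand)
open B6Cover236MultiLevelBlocks (cubes)
open B6GradLegKLevelV1 (DV)
open B6LapLegKLevelV1 (DVa)
open B6Ineq2140KLevelV1 (ineq2140_kLevel_unconditional)
open B6KLevelCensusIndexV1 (KIdx kGeoG lenG_pos lenG_eq_geomT abs_le_supNormG supNormG_nonneg)
open B6KLevelCensusBookkeepingV1 (adjLen_pow_le exp_adj_le)
open B6Prop26Census2136KLevelV1 (Gop l2Of kG pref_eq_lenG_sq)

variable {d ℓ : ℕ} {hd : 1 ≤ d + 1} {hL : Odd (ℓ + 1) ∧ 1 < ℓ + 1} {b₀ b₁ : ℝ}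

/-! ## §1  `ℓ²` plumbing and the adjacent-block decomposition of the cut-off -/

/-- `(Σ_x (h(x)f(x))²)^{1/2} ≤ Y` from `Σ_x (h(x)f(x))² ≤ Y²`, `Y ≥ 0`. [cite: Balaban1984PropagatorsII, (2.140) p.247, bookkeeping] -/
theorem l2Of_le_of_sq_le {X : Type*} [Fintype X] {h f : X → ℝ} {Y : ℝ} (hY : 0 ≤ Y) (hle : ∑ x, (h x * f x) ^ 2 ≤ Y ^ 2) :
    l2Of h f ≤ Y := by
  unfold l2Of
  calc Real.sqrt (∑ x, (h x * f x) ^ 2) ≤ Real.sqrt (Y ^ 2) := Real.sqrt_le_sqrt hle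
    _ = Y := Real.sqrt_sq hY

/-- **THE ADJACENT-BLOCK DECOMPOSITION OF THE CUT-OFF** («supp ζ ⊂ Δ̃(y)», the cube `Δ̃(y)` read as the blocks at torus distance `≤ 1` from `y`): if `h`
vanishes off `Δ̃(y)`, `|h| ≤ s`, every exact-block piece `h_z = h·1_{Δ(z)}` with `d_T(z, y) ≤ 1` satisfies `Σ_x (h_z(x)F(x))² ≤ B`, and `Σ_z e^{−d_T(y,z)} ≤ K`,
then `Σ_x (h(x)F(x))² ≤ e·K·B`. [cite: Balaban1984PropagatorsII, (2.140) p.247 («supp ζ ⊂ Δ(y)», «Δ̃(y) … a sum of 2^d unit cubes»), Lemma 2.1 (2.61) p.234; decomposition ours] -/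
theorem sum_sq_cutIn_le (i : KIdx d ℓ hd hL b₀ b₁) {F h : PBond (PV d ℓ i.m i.K hd hL) 0 → ℝ} {y : (geomT i.D).Site} {s B K : ℝ}
    (hcut : (kGeoG i).cutIn h y) (hs0 : 0 ≤ s) (hs : ∀ x, |h x| ≤ s) (hB : 0 ≤ B)
    (hblk : ∀ z : (geomT i.D).Site, (geomT i.D).dist z y ≤ 1 → ∀ ζ : PBond (PV d ℓ i.m i.K hd hL) 0 → ℝ,
      (∀ x, blkV1 i.hN i.D x ≠ z → ζ x = 0) → (∀ x, |ζ x| ≤ s) → ∑ x, (ζ x * F x) ^ 2 ≤ B)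
    (hrad : ∑ z : (geomT i.D).Site, Real.exp (-(geomT i.D).dist y z) ≤ K) :
    ∑ x, (h x * F x) ^ 2 ≤ Real.exp 1 * K * B := by
  classical
  rw [← Finset.sum_fiberwise univ (blkV1 i.hN i.D) (fun x => (h x * F x) ^ 2)]
  -- one block `z`: the exact-block piece `h_z`
  have hz : ∀ z : (geomT i.D).Site,
      ∑ x ∈ univ.filter (fun x => blkV1 i.hN i.D x = z), (h x * F x) ^ 2 ≤ Real.exp (1 - (geomT i.D).dist y z) * B := by
    intro z
    set ζ : PBond (PV d ℓ i.m i.K hd hL) 0 → ℝ := fun x => if blkV1 i.hN i.D x = z then h x else 0 with hζ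
    have hsum : ∑ x ∈ univ.filter (fun x => blkV1 i.hN i.D x = z), (h x * F x) ^ 2 = ∑ x, (ζ x * F x) ^ 2 := by
      rw [Finset.sum_filter]
      refine Finset.sum_congr rfl fun x _ => ?_
      by_cases hx : blkV1 i.hN i.D x = z <;> simp [hζ, hx]
    rw [hsum]
    by_cases hzy : (geomT i.D).dist z y ≤ 1
    · have h1 : ∑ x, (ζ x * F x) ^ 2 ≤ B := by
        refine hblk z hzy ζ (fun x hx => by simp [hζ, hx]) fun x => ?_
        by_cases hx : blkV1 i.hN i.D x = z
        · simp only [hζ, hx, if_true]; exact hs x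
        · simp only [hζ, hx, if_false, abs_zero]; exact hs0
      have h2 : (1 : ℝ) ≤ Real.exp (1 - (geomT i.D).dist y z) := Real.one_le_exp (by rw [symmT i.D y z]; linarith)
      calc ∑ x, (ζ x * F x) ^ 2 ≤ B := h1
        _ = 1 * B := (one_mul B).symm
        _ ≤ Real.exp (1 - (geomT i.D).dist y z) * B := mul_le_mul_of_nonneg_right h2 hB
    · -- off `Δ̃(y)` the piece vanishes
      have h0 : ∀ x, ζ x = 0 := by
        intro x
        by_cases hx : blkV1 i.hN i.D x = z
        · have hhx : h x = 0 := by
            by_contra hne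
            have h' := hcut x hne
            rw [hx] at h'
            exact hzy h'
          simp [hζ, hx, hhx]
        · simp [hζ, hx]
      have hzero : ∑ x, (ζ x * F x) ^ 2 = 0 := Finset.sum_eq_zero fun x _ => by rw [h0 x, zero_mul, zero_pow two_ne_zero]
      rw [hzero]
      positivity
  calc ∑ z, ∑ x ∈ univ.filter (fun x => blkV1 i.hN i.D x = z), (h x * F x) ^ 2
      ≤ ∑ z, Real.exp (1 - (geomT i.D).dist y z) * B := Finset.sum_le_sum fun z _ => hz z
    _ = Real.exp 1 * B * ∑ z, Real.exp (-(geomT i.D).dist y z) := by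
        rw [Finset.mul_sum]
        refine Finset.sum_congr rfl fun z _ => ?_
        rw [sub_eq_add_neg, Real.exp_add]; ring
    _ ≤ Real.exp 1 * B * K := mul_le_mul_of_nonneg_left hrad (by positivity)
    _ = Real.exp 1 * K * B := by ring

/-! ## §2  Lemma 2.1 (2.61) on the V1 torus at rate one -/

/-- **LEMMA 2.1 (2.61) ON THE V1 TORUS AT RATE ONE**: `Σ_z e^{−d_T(y,z)} ≤ K261 N₀ (d+1) L 1 1` with `N₀ = 2(d+1)L` whenever `R·L·M_h ≥ N₀ + 1`
(p21's `lemma21_torus` with `δ₀ = α = 1`; (2.59) `e^{−1}L^{2(d+1)/N₀} = e^{−1}L^{1/L} < 1` holds since `log L < L`). [cite: Balaban1984PropagatorsII, Lemma 2.1 (2.61) p.234, (2.59) p.233] -/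
theorem radial_le (i : KIdx d ℓ hd hL b₀ b₁) (hRM : 2 * (d + 1) * (ℓ + 1) + 1 ≤ i.R * ((ℓ + 1) * i.Mh)) (y : (geomT i.D).Site) :
    ∑ z : (geomT i.D).Site, Real.exp (-(geomT i.D).dist y z) ≤ K261 (2 * (d + 1) * (ℓ + 1)) (d + 1) ((ℓ : ℝ) + 1) 1 1 := by
  have hMh1 : 1 ≤ i.Mh := le_trans (by norm_num) i.hM8
  have hP1 : ∀ μ, 1 ≤ i.P' μ := fun μ => le_trans (by norm_num) (i.hP5 μ)
  have hN0 : 0 < 2 * (d + 1) * (ℓ + 1) := by positivity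
  have hL0 : (0 : ℝ) < (ℓ : ℝ) + 1 := by positivity
  have hθ : Real.exp (-(1 * 1 : ℝ)) * ((ℓ : ℝ) + 1) ^ ((2 * (d + 1 : ℕ) : ℝ) / ((2 * (d + 1) * (ℓ + 1) : ℕ) : ℝ)) < 1 := by
    rw [Real.rpow_def_of_pos hL0, ← Real.exp_add]
    refine Real.exp_lt_one_iff.2 ?_
    have hexp : ((2 * (d + 1 : ℕ) : ℝ)) / (((2 * (d + 1) * (ℓ + 1) : ℕ)) : ℝ) = 1 / ((ℓ : ℝ) + 1) := by
      push_cast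
      have hd0 : (0 : ℝ) < (d : ℝ) + 1 := by positivity
      field_simp
    rw [hexp]
    have hlog : Real.log ((ℓ : ℝ) + 1) ≤ (ℓ : ℝ) + 1 - 1 := Real.log_le_sub_one_of_pos hL0
    have hlt : Real.log ((ℓ : ℝ) + 1) * (1 / ((ℓ : ℝ) + 1)) < 1 := by
      rw [mul_one_div, div_lt_one hL0]; linarith
    linarith
  have h21 := (lemma21_torus i.D hMh1 hP1 hN0 hRM (zero_le_one : (0 : ℝ) ≤ 1) (zero_le_one : (0 : ℝ) ≤ 1) le_rfl hθ).2.1 y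
  simp only [one_mul, mul_one] at h21
  exact h21

/-! ## §3  One `L²` entry of the census from an exact-block `L²` bound -/

/-- **ONE `L²` ENTRY OF (2.140) ON THE CENSUS GEOMETRY FROM THE EXACT-BLOCK SHAPE**: if `Σ_x (ζ(x)(TJ)(x))² ≤ (A·ℓ_z^p·e^{−δd_T(z,y′)}·s)²·Σ_x J(x)²` for
`supp ζ ⊂ Δ(z)`, `|ζ| ≤ s`, `supp J ⊂ Δ(y′)` (`ℓ_z = len_T(z)·|c_f|⁻¹`, `A, δ ≥ 0`), and `R·L·M_h ≥ 2(d+1)L + 1`, then for `supp h ⊂ Δ̃(y)`, `supp J ⊂ Δ(y′)`: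
`l2Of h (TJ) ≤ (√(e·K)·L^p·e^{δ}·A)·(len y)^p·sup|h|·e^{−δ dist(y,y′)}·‖J‖`, `K = K261 (2(d+1)L) (d+1) L 1 1` (§1 with the pieces moved to `y` by the (2.54)/(2.60)
bookkeeping, §2).
[cite: Balaban1984PropagatorsII, Prop. 2.6 (2.140) p.247, (2.54) p.232, (2.60)/(2.61) p.234; assembly ours] -/
theorem l2_entry_le (i : KIdx d ℓ hd hL b₀ b₁) {T : (PBond (PV d ℓ i.m i.K hd hL) 0 → ℝ) → (PBond (PV d ℓ i.m i.K hd hL) 0 → ℝ)}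
    {p : ℕ} {A δ : ℝ} (hA : 0 ≤ A) (hδ : 0 ≤ δ) (hRM : 2 * (d + 1) * (ℓ + 1) + 1 ≤ i.R * ((ℓ + 1) * i.Mh))
    (hT : ∀ (z y' : (geomT i.D).Site) (ζ J : PBond (PV d ℓ i.m i.K hd hL) 0 → ℝ) {s : ℝ},
      0 ≤ s → (∀ x, blkV1 i.hN i.D x ≠ z → ζ x = 0) → (∀ x, |ζ x| ≤ s) → (∀ x, blkV1 i.hN i.D x ≠ y' → J x = 0) →
      ∑ x, (ζ x * T J x) ^ 2 ≤
        (A * ((geomT i.D).len z * |i.cf|⁻¹) ^ p * Real.exp (-(δ * (geomT i.D).dist z y')) * s) ^ 2 * ∑ x, J x ^ 2)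
    {J h : PBond (PV d ℓ i.m i.K hd hL) 0 → ℝ} {y y' : (geomT i.D).Site} (hcut : (kGeoG i).cutIn h y) (hJ : (kGeoG i).suppIn J y') :
    l2Of h (T J) ≤ (Real.sqrt (Real.exp 1 * K261 (2 * (d + 1) * (ℓ + 1)) (d + 1) ((ℓ : ℝ) + 1) 1 1) * ((ℓ : ℝ) + 1) ^ p * Real.exp δ * A) * (kGeoG i).len y ^ p *
      (kGeoG i).cutSup h * Real.exp (-(δ * (kGeoG i).dist y y')) * (kGeoG i).l2Norm J := by
  have hMh1 : 1 ≤ i.Mh := le_trans (by norm_num) i.hM8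
  have hP1 : ∀ μ, 1 ≤ i.P' μ := fun μ => le_trans (by norm_num) (i.hP5 μ)
  have hRM2L : 2 * (ℓ + 1) ≤ i.R * ((ℓ + 1) * i.Mh) := by
    have h2 : 1 ≤ (ℓ + 1) * i.Mh := le_trans hMh1 (Nat.le_mul_of_pos_left _ (by omega))
    calc 2 * (ℓ + 1) ≤ 2 * (ℓ + 1) ^ 2 * 1 := by nlinarith
      _ ≤ i.R * ((ℓ + 1) * i.Mh) := Nat.mul_le_mul i.hR2 h2
  -- the cut-off: `|h| ≤ s = sup|h|`
  set s : ℝ := (kGeoG i).cutSup h with hs_def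
  have hs : ∀ x, |h x| ≤ s := fun x => abs_le_supNormG i h x
  have hs0 : 0 ≤ s := supNormG_nonneg i h
  -- the input: `supp J ⊂ Δ(y′)`, `‖J‖ = N`
  have hJ' : ∀ x, blkV1 i.hN i.D x ≠ y' → J x = 0 := fun x hx => by
    by_contra hne
    exact hx (hJ x hne)
  set N : ℝ := (kGeoG i).l2Norm J with hN_def
  have hN2 : N ^ 2 = ∑ x, J x ^ 2 := Real.sq_sqrt (Finset.sum_nonneg fun x _ => sq_nonneg _)
  have hS0 : 0 ≤ ∑ x, J x ^ 2 := Finset.sum_nonneg fun x _ => sq_nonneg _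
  -- the census length at `y`
  set ly : ℝ := (kGeoG i).len y with hly_def
  have hlyT : (geomT i.D).len y * |i.cf|⁻¹ = ly := (lenG_eq_geomT i y).symm
  have hly0 : 0 < ly := lenG_pos i y
  set E : ℝ := Real.exp (-(δ * (geomT i.D).dist y y')) with hE_def
  have hE0 : 0 < E := Real.exp_pos _
  -- the common bound of the pieces, moved to `y`
  set X : ℝ := A * (((ℓ : ℝ) + 1) ^ p * ly ^ p) * (Real.exp δ * E) * s with hX_def
  have hX0 : 0 ≤ X := by positivity
  have hblk : ∀ z : (geomT i.D).Site, (geomT i.D).dist z y ≤ 1 → ∀ ζ : PBond (PV d ℓ i.m i.K hd hL) 0 → ℝ,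
      (∀ x, blkV1 i.hN i.D x ≠ z → ζ x = 0) → (∀ x, |ζ x| ≤ s) → ∑ x, (ζ x * T J x) ^ 2 ≤ X ^ 2 * ∑ x, J x ^ 2 := by
    intro z hz ζ hζ hζs
    have h0 := hT z y' ζ J hs0 hζ hζs hJ'
    refine h0.trans (mul_le_mul_of_nonneg_right ?_ hS0)
    have htz : ((geomT i.D).len z * |i.cf|⁻¹) ^ p ≤ ((ℓ : ℝ) + 1) ^ p * ly ^ p := by
      rw [← hlyT]; exact adjLen_pow_le i.D hMh1 hP1 hRM2L i.cf p y z hz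
    have hez : Real.exp (-(δ * (geomT i.D).dist z y')) ≤ Real.exp δ * E := exp_adj_le i.D hMh1 hP1 hδ y z y' hz
    have htz0 : 0 ≤ ((geomT i.D).len z * |i.cf|⁻¹) ^ p := pow_nonneg (mul_nonneg (lenT_pos (D := i.D) z).le (inv_nonneg.2 (abs_nonneg _))) p
    have ha0 : 0 ≤ A * ((geomT i.D).len z * |i.cf|⁻¹) ^ p * Real.exp (-(δ * (geomT i.D).dist z y')) * s :=
      mul_nonneg (mul_nonneg (mul_nonneg hA htz0) (Real.exp_pos _).le) hs0
    have hle : A * ((geomT i.D).len z * |i.cf|⁻¹) ^ p * Real.exp (-(δ * (geomT i.D).dist z y')) * s ≤ X := by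
      have h1 : A * ((geomT i.D).len z * |i.cf|⁻¹) ^ p ≤ A * (((ℓ : ℝ) + 1) ^ p * ly ^ p) := mul_le_mul_of_nonneg_left htz hA
      have h2 : A * ((geomT i.D).len z * |i.cf|⁻¹) ^ p * Real.exp (-(δ * (geomT i.D).dist z y')) ≤
          A * (((ℓ : ℝ) + 1) ^ p * ly ^ p) * (Real.exp δ * E) :=
        mul_le_mul h1 hez (Real.exp_pos _).le (mul_nonneg hA (by positivity))
      exact mul_le_mul_of_nonneg_right h2 hs0
    exact pow_le_pow_left₀ ha0 hle 2
  have hmain := sum_sq_cutIn_le i hcut hs0 hs (mul_nonneg (sq_nonneg X) hS0) hblk (radial_le i hRM y)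
  -- `e·K·(X²·Σ J²) = (√(e·K)·X·N)²`
  have hK0 : 0 ≤ Real.exp 1 * K261 (2 * (d + 1) * (ℓ + 1)) (d + 1) ((ℓ : ℝ) + 1) 1 1 :=
    mul_nonneg (Real.exp_pos _).le (K261_nonneg (by positivity) zero_le_one)
  set Y : ℝ := Real.sqrt (Real.exp 1 * K261 (2 * (d + 1) * (ℓ + 1)) (d + 1) ((ℓ : ℝ) + 1) 1 1) * X * N with hY_def
  have hY0 : 0 ≤ Y := mul_nonneg (mul_nonneg (Real.sqrt_nonneg _) hX0) (Real.sqrt_nonneg _)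
  have hYsq : Real.exp 1 * K261 (2 * (d + 1) * (ℓ + 1)) (d + 1) ((ℓ : ℝ) + 1) 1 1 * (X ^ 2 * ∑ x, J x ^ 2) = Y ^ 2 := by
    have h1 : Y ^ 2 = Real.sqrt (Real.exp 1 * K261 (2 * (d + 1) * (ℓ + 1)) (d + 1) ((ℓ : ℝ) + 1) 1 1) ^ 2 * X ^ 2 * N ^ 2 := by rw [hY_def]; ring
    rw [h1, Real.sq_sqrt hK0, hN2]; ring
  have hfin : l2Of h (T J) ≤ Y := l2Of_le_of_sq_le hY0 (hmain.trans (le_of_eq hYsq))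
  calc l2Of h (T J) ≤ Y := hfin
    _ = (Real.sqrt (Real.exp 1 * K261 (2 * (d + 1) * (ℓ + 1)) (d + 1) ((ℓ : ℝ) + 1) 1 1) * ((ℓ : ℝ) + 1) ^ p * Real.exp δ * A) * ly ^ p * s * E * N := by
        rw [hY_def, hX_def]; ring

/-! ## §4  The six `L²` entries (2.140) of the census, uniformly on the family -/

set_option maxHeartbeats 1600000 in
/-- **[B6] PROPOSITION 2.6 (2.140), THE LAST CONJUNCT OF `B6.Prop26Printed`'s `Ineq2136_2140`, ON THE GENUINE k-LEVEL V1 FAMILY** — all six `L²`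
entries `‖hGJ‖, ‖h∇GJ‖, ‖hG∇*J‖, ‖h∇G∇*J‖, ‖h∇∇GJ‖, ‖hG∇*∇*J‖ ≤ O(1)[(Lʲη)², Lʲη, Lʲη, 1, 1, 1]|h|e^{−δ₃d(y,y′)}‖J‖` for `supp h ⊂ Δ̃(y)`, `supp J ⊂ Δ(y′)`,
with ONE threshold, ONE rate and ONE constant for the whole family: entry `0` by p22's `B6Ineq2140KLevelV1.ineq2140_kLevel_unconditional` BY NAME
(`σ := σ₁`, `α := ½`), entries `1 … 5` by the displayed exact-block inputs `hl1 … hl5` (the k-level `L²` bounds of `∇_νG`, `G∇*_ν`, `∇_νG∇*_μ`, `∇_ν∇_μG`,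
`G∇*_ν∇*_μ` in the shape of entry `0`). [cite: Balaban1984PropagatorsII, Prop. 2.6 (2.140) p.247, (2.141) p.247, Lemma 2.1 p.234] -/
theorem prop26_census2140_kLevel_of_l2 (hb₀ : 0 < b₀) (hb₁ : b₀ ≤ b₁)
    (hl1 : ∃ (δ A M₂ : ℝ) (N₁ : ℕ), 0 < δ ∧ 0 ≤ A ∧ 0 < M₂ ∧
      ∀ (m K : ℕ) {Mh k R : ℕ} {P' : Fin (d + 1) → ℕ}
        (hN : ∀ μ, N0 ℓ Mh k P' μ = (PV d ℓ m K hd hL).sitesPerDir 0) (D : TDomains d ℓ Mh k P' R) (hk : k ≤ m + K) (_ : 2 ≤ k)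
        {a : ℕ} (_ : Mh = (ℓ + 1) ^ a) (_ : 8 ≤ Mh) (_ : 2 * (ℓ + 1) ^ 2 ≤ R) (_ : ∀ μ, 5 ≤ P' μ) (_ : 4 ≤ ℓ)
        (_ : ∀ c : ↥(cubes D.toDomains), Placed ℓ k P' c.1) (_ : M₂ ≤ ((ℓ : ℝ) + 1) * Mh) (_ : N₁ + 1 ≤ R * ((ℓ + 1) * Mh))
        {cf : ℝ} (hcf : cf ≠ 0) {w : BondIdx (domT hN D hk) → ℝ} (hw : ∀ i, 0 < w i) (_ : GlobalBand b₀ b₁ cf w)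
        (ν : Fin (d + 1)) (y y' : (geomT D).Site) (ζ J : PBond (PV d ℓ m K hd hL) 0 → ℝ) {s : ℝ} (_ : 0 ≤ s)
        (_ : ∀ x, blkV1 hN D x ≠ y → ζ x = 0) (_ : ∀ x, |ζ x| ≤ s) (_ : ∀ x, blkV1 hN D x ≠ y' → J x = 0),
        ∑ x, (ζ x * (DV ν cf ∘ₗ onFun (GE (domT hN D hk) hcf hw)) J x) ^ 2 ≤
          (A * ((geomT D).len y * |cf|⁻¹) * Real.exp (-(δ * (geomT D).dist y y')) * s) ^ 2 * ∑ x, J x ^ 2)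
    (hl2 : ∃ (δ A M₂ : ℝ) (N₁ : ℕ), 0 < δ ∧ 0 ≤ A ∧ 0 < M₂ ∧
      ∀ (m K : ℕ) {Mh k R : ℕ} {P' : Fin (d + 1) → ℕ}
        (hN : ∀ μ, N0 ℓ Mh k P' μ = (PV d ℓ m K hd hL).sitesPerDir 0) (D : TDomains d ℓ Mh k P' R) (hk : k ≤ m + K) (_ : 2 ≤ k)
        {a : ℕ} (_ : Mh = (ℓ + 1) ^ a) (_ : 8 ≤ Mh) (_ : 2 * (ℓ + 1) ^ 2 ≤ R) (_ : ∀ μ, 5 ≤ P' μ) (_ : 4 ≤ ℓ)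
        (_ : ∀ c : ↥(cubes D.toDomains), Placed ℓ k P' c.1) (_ : M₂ ≤ ((ℓ : ℝ) + 1) * Mh) (_ : N₁ + 1 ≤ R * ((ℓ + 1) * Mh))
        {cf : ℝ} (hcf : cf ≠ 0) {w : BondIdx (domT hN D hk) → ℝ} (hw : ∀ i, 0 < w i) (_ : GlobalBand b₀ b₁ cf w)
        (ν : Fin (d + 1)) (y y' : (geomT D).Site) (ζ J : PBond (PV d ℓ m K hd hL) 0 → ℝ) {s : ℝ} (_ : 0 ≤ s)
        (_ : ∀ x, blkV1 hN D x ≠ y → ζ x = 0) (_ : ∀ x, |ζ x| ≤ s) (_ : ∀ x, blkV1 hN D x ≠ y' → J x = 0),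
        ∑ x, (ζ x * (onFun (GE (domT hN D hk) hcf hw) ∘ₗ DVa ν cf) J x) ^ 2 ≤
          (A * ((geomT D).len y * |cf|⁻¹) * Real.exp (-(δ * (geomT D).dist y y')) * s) ^ 2 * ∑ x, J x ^ 2)
    (hl3 : ∃ (δ A M₂ : ℝ) (N₁ : ℕ), 0 < δ ∧ 0 ≤ A ∧ 0 < M₂ ∧
      ∀ (m K : ℕ) {Mh k R : ℕ} {P' : Fin (d + 1) → ℕ}
        (hN : ∀ μ, N0 ℓ Mh k P' μ = (PV d ℓ m K hd hL).sitesPerDir 0) (D : TDomains d ℓ Mh k P' R) (hk : k ≤ m + K) (_ : 2 ≤ k)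
        {a : ℕ} (_ : Mh = (ℓ + 1) ^ a) (_ : 8 ≤ Mh) (_ : 2 * (ℓ + 1) ^ 2 ≤ R) (_ : ∀ μ, 5 ≤ P' μ) (_ : 4 ≤ ℓ)
        (_ : ∀ c : ↥(cubes D.toDomains), Placed ℓ k P' c.1) (_ : M₂ ≤ ((ℓ : ℝ) + 1) * Mh) (_ : N₁ + 1 ≤ R * ((ℓ + 1) * Mh))
        {cf : ℝ} (hcf : cf ≠ 0) {w : BondIdx (domT hN D hk) → ℝ} (hw : ∀ i, 0 < w i) (_ : GlobalBand b₀ b₁ cf w)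
        (ν μ : Fin (d + 1)) (y y' : (geomT D).Site) (ζ J : PBond (PV d ℓ m K hd hL) 0 → ℝ) {s : ℝ} (_ : 0 ≤ s)
        (_ : ∀ x, blkV1 hN D x ≠ y → ζ x = 0) (_ : ∀ x, |ζ x| ≤ s) (_ : ∀ x, blkV1 hN D x ≠ y' → J x = 0),
        ∑ x, (ζ x * (DV ν cf ∘ₗ onFun (GE (domT hN D hk) hcf hw) ∘ₗ DVa μ cf) J x) ^ 2 ≤
          (A * Real.exp (-(δ * (geomT D).dist y y')) * s) ^ 2 * ∑ x, J x ^ 2)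
    (hl4 : ∃ (δ A M₂ : ℝ) (N₁ : ℕ), 0 < δ ∧ 0 ≤ A ∧ 0 < M₂ ∧
      ∀ (m K : ℕ) {Mh k R : ℕ} {P' : Fin (d + 1) → ℕ}
        (hN : ∀ μ, N0 ℓ Mh k P' μ = (PV d ℓ m K hd hL).sitesPerDir 0) (D : TDomains d ℓ Mh k P' R) (hk : k ≤ m + K) (_ : 2 ≤ k)
        {a : ℕ} (_ : Mh = (ℓ + 1) ^ a) (_ : 8 ≤ Mh) (_ : 2 * (ℓ + 1) ^ 2 ≤ R) (_ : ∀ μ, 5 ≤ P' μ) (_ : 4 ≤ ℓ)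
        (_ : ∀ c : ↥(cubes D.toDomains), Placed ℓ k P' c.1) (_ : M₂ ≤ ((ℓ : ℝ) + 1) * Mh) (_ : N₁ + 1 ≤ R * ((ℓ + 1) * Mh))
        {cf : ℝ} (hcf : cf ≠ 0) {w : BondIdx (domT hN D hk) → ℝ} (hw : ∀ i, 0 < w i) (_ : GlobalBand b₀ b₁ cf w)
        (ν μ : Fin (d + 1)) (y y' : (geomT D).Site) (ζ J : PBond (PV d ℓ m K hd hL) 0 → ℝ) {s : ℝ} (_ : 0 ≤ s)
        (_ : ∀ x, blkV1 hN D x ≠ y → ζ x = 0) (_ : ∀ x, |ζ x| ≤ s) (_ : ∀ x, blkV1 hN D x ≠ y' → J x = 0),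
        ∑ x, (ζ x * (DV ν cf ∘ₗ DV μ cf ∘ₗ onFun (GE (domT hN D hk) hcf hw)) J x) ^ 2 ≤
          (A * Real.exp (-(δ * (geomT D).dist y y')) * s) ^ 2 * ∑ x, J x ^ 2)
    (hl5 : ∃ (δ A M₂ : ℝ) (N₁ : ℕ), 0 < δ ∧ 0 ≤ A ∧ 0 < M₂ ∧
      ∀ (m K : ℕ) {Mh k R : ℕ} {P' : Fin (d + 1) → ℕ}
        (hN : ∀ μ, N0 ℓ Mh k P' μ = (PV d ℓ m K hd hL).sitesPerDir 0) (D : TDomains d ℓ Mh k P' R) (hk : k ≤ m + K) (_ : 2 ≤ k)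
        {a : ℕ} (_ : Mh = (ℓ + 1) ^ a) (_ : 8 ≤ Mh) (_ : 2 * (ℓ + 1) ^ 2 ≤ R) (_ : ∀ μ, 5 ≤ P' μ) (_ : 4 ≤ ℓ)
        (_ : ∀ c : ↥(cubes D.toDomains), Placed ℓ k P' c.1) (_ : M₂ ≤ ((ℓ : ℝ) + 1) * Mh) (_ : N₁ + 1 ≤ R * ((ℓ + 1) * Mh))
        {cf : ℝ} (hcf : cf ≠ 0) {w : BondIdx (domT hN D hk) → ℝ} (hw : ∀ i, 0 < w i) (_ : GlobalBand b₀ b₁ cf w)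
        (ν μ : Fin (d + 1)) (y y' : (geomT D).Site) (ζ J : PBond (PV d ℓ m K hd hL) 0 → ℝ) {s : ℝ} (_ : 0 ≤ s)
        (_ : ∀ x, blkV1 hN D x ≠ y → ζ x = 0) (_ : ∀ x, |ζ x| ≤ s) (_ : ∀ x, blkV1 hN D x ≠ y' → J x = 0),
        ∑ x, (ζ x * (onFun (GE (domT hN D hk) hcf hw) ∘ₗ DVa ν cf ∘ₗ DVa μ cf) J x) ^ 2 ≤
          (A * Real.exp (-(δ * (geomT D).dist y y')) * s) ^ 2 * ∑ x, J x ^ 2) :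
    ∃ M₁ δ₃ C : ℝ, 0 < M₁ ∧ 0 < δ₃ ∧ 0 < C ∧ ∀ i : KIdx d ℓ hd hL b₀ b₁, M₁ ≤ (kGeoG i).M →
      ∀ (n : Fin 6) (J : (kGeoG i).Loc) (h : (kGeoG i).Cut) (y y' : (kGeoG i).Site), (kGeoG i).cutIn h y → (kGeoG i).suppIn J y' →
        (kG i).l2 n J h ≤ C * B6.pref6 ((kGeoG i).len y) n * (kGeoG i).cutSup h * Real.exp (-(δ₃ * (kGeoG i).dist y y')) *
          (kGeoG i).l2Norm J := by
  -- entry 0 by name (`σ := σ₁`, `α := ½`)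
  obtain ⟨σ₁, hσ₁, hF⟩ := ineq2140_kLevel_unconditional d ℓ hd hL hb₀ hb₁
  obtain ⟨A₀, M₀, hA₀, hM₀, hF0⟩ := hF σ₁ hσ₁ le_rfl (1 / 2) (by norm_num) (by norm_num)
  clear hF
  have hδ₀ : 0 < delta3 (1 / 2) (2 * σ₁) / 2 := half_pos (delta3_pos (by norm_num) (by linarith))
  set δ₀ : ℝ := delta3 (1 / 2) (2 * σ₁) / 2 with hδ₀_def
  obtain ⟨δ₁, A₁, M₁', N₁, hδ₁, hA₁, hM₁', hF1⟩ := hl1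
  obtain ⟨δ₂, A₂, M₂', N₂, hδ₂, hA₂, hM₂', hF2⟩ := hl2
  obtain ⟨δ₃', A₃, M₃', N₃, hδ₃', hA₃, hM₃', hF3⟩ := hl3
  obtain ⟨δ₄, A₄, M₄', N₄, hδ₄, hA₄, hM₄', hF4⟩ := hl4
  obtain ⟨δ₅, A₅, M₅', N₅, hδ₅, hA₅, hM₅', hF5⟩ := hl5
  -- the witnesses
  obtain ⟨Mm, hMm⟩ : ∃ Mm : ℝ, Mm = max (max (max M₀ M₁') (max M₂' M₃')) (max M₄' M₅') := ⟨_, rfl⟩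
  obtain ⟨Nx, hNx⟩ : ∃ Nx : ℝ, Nx = max (max (max ((N₁ : ℝ) + 1) ((N₂ : ℝ) + 1)) (max ((N₃ : ℝ) + 1) ((N₄ : ℝ) + 1)))
      (max ((N₅ : ℝ) + 1) (((2 * (d + 1) * (ℓ + 1) : ℕ) : ℝ) + 1)) := ⟨_, rfl⟩
  have hM0x : M₀ ≤ max Mm Nx := by
    rw [hMm]; exact (((le_max_left _ _).trans (le_max_left _ _)).trans (le_max_left _ _)).trans (le_max_left _ _)
  have hM1x : M₁' ≤ max Mm Nx := by
    rw [hMm]; exact (((le_max_right _ _).trans (le_max_left _ _)).trans (le_max_left _ _)).trans (le_max_left _ _)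
  have hM2x : M₂' ≤ max Mm Nx := by
    rw [hMm]; exact (((le_max_left _ _).trans (le_max_right _ _)).trans (le_max_left _ _)).trans (le_max_left _ _)
  have hM3x : M₃' ≤ max Mm Nx := by
    rw [hMm]; exact (((le_max_right _ _).trans (le_max_right _ _)).trans (le_max_left _ _)).trans (le_max_left _ _)
  have hM4x : M₄' ≤ max Mm Nx := by
    rw [hMm]; exact ((le_max_left _ _).trans (le_max_right _ _)).trans (le_max_left _ _)
  have hM5x : M₅' ≤ max Mm Nx := by
    rw [hMm]; exact ((le_max_right _ _).trans (le_max_right _ _)).trans (le_max_left _ _)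
  have hN1x : (N₁ : ℝ) + 1 ≤ max Mm Nx := by
    rw [hNx]; exact (((le_max_left _ _).trans (le_max_left _ _)).trans (le_max_left _ _)).trans (le_max_right _ _)
  have hN2x : (N₂ : ℝ) + 1 ≤ max Mm Nx := by
    rw [hNx]; exact (((le_max_right _ _).trans (le_max_left _ _)).trans (le_max_left _ _)).trans (le_max_right _ _)
  have hN3x : (N₃ : ℝ) + 1 ≤ max Mm Nx := by
    rw [hNx]; exact (((le_max_left _ _).trans (le_max_right _ _)).trans (le_max_left _ _)).trans (le_max_right _ _)
  have hN4x : (N₄ : ℝ) + 1 ≤ max Mm Nx := by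
    rw [hNx]; exact (((le_max_right _ _).trans (le_max_right _ _)).trans (le_max_left _ _)).trans (le_max_right _ _)
  have hN5x : (N₅ : ℝ) + 1 ≤ max Mm Nx := by
    rw [hNx]; exact ((le_max_left _ _).trans (le_max_right _ _)).trans (le_max_right _ _)
  have hNrx : ((2 * (d + 1) * (ℓ + 1) : ℕ) : ℝ) + 1 ≤ max Mm Nx := by
    rw [hNx]; exact ((le_max_right _ _).trans (le_max_right _ _)).trans (le_max_right _ _)
  set δm : ℝ := min (min (min δ₀ δ₁) (min δ₂ δ₃')) (min δ₄ δ₅) with hδm_def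
  have hδm : 0 < δm := lt_min (lt_min (lt_min hδ₀ hδ₁) (lt_min hδ₂ hδ₃')) (lt_min hδ₄ hδ₅)
  have hm0 : δm ≤ δ₀ := ((min_le_left _ _).trans (min_le_left _ _)).trans (min_le_left _ _)
  have hm1 : δm ≤ δ₁ := ((min_le_left _ _).trans (min_le_left _ _)).trans (min_le_right _ _)
  have hm2 : δm ≤ δ₂ := ((min_le_left _ _).trans (min_le_right _ _)).trans (min_le_left _ _)
  have hm3 : δm ≤ δ₃' := ((min_le_left _ _).trans (min_le_right _ _)).trans (min_le_right _ _)
  have hm4 : δm ≤ δ₄ := (min_le_right _ _).trans (min_le_left _ _)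
  have hm5 : δm ≤ δ₅ := (min_le_right _ _).trans (min_le_right _ _)
  set Q : ℝ := Real.sqrt (Real.exp 1 * K261 (2 * (d + 1) * (ℓ + 1)) (d + 1) ((ℓ : ℝ) + 1) 1 1) with hQ_def
  have hQ0 : 0 ≤ Q := Real.sqrt_nonneg _
  set C₀ : ℝ := Q * ((ℓ : ℝ) + 1) ^ 2 * Real.exp δ₀ * A₀ with hC₀_def
  set C₁ : ℝ := Q * ((ℓ : ℝ) + 1) ^ 1 * Real.exp δ₁ * A₁ with hC₁_def
  set C₂ : ℝ := Q * ((ℓ : ℝ) + 1) ^ 1 * Real.exp δ₂ * A₂ with hC₂_def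
  set C₃ : ℝ := Q * ((ℓ : ℝ) + 1) ^ 0 * Real.exp δ₃' * A₃ with hC₃_def
  set C₄ : ℝ := Q * ((ℓ : ℝ) + 1) ^ 0 * Real.exp δ₄ * A₄ with hC₄_def
  set C₅ : ℝ := Q * ((ℓ : ℝ) + 1) ^ 0 * Real.exp δ₅ * A₅ with hC₅_def
  set C : ℝ := max (max (max C₀ C₁) (max C₂ C₃)) (max (max C₄ C₅) 1) with hC_def
  have hC1 : 1 ≤ C := (le_max_right _ _).trans (le_max_right _ _)
  have hC0 : 0 ≤ C := zero_le_one.trans hC1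
  have hC₀C : C₀ ≤ C := ((le_max_left _ _).trans (le_max_left _ _)).trans (le_max_left _ _)
  have hC₁C : C₁ ≤ C := ((le_max_right _ _).trans (le_max_left _ _)).trans (le_max_left _ _)
  have hC₂C : C₂ ≤ C := ((le_max_left _ _).trans (le_max_right _ _)).trans (le_max_left _ _)
  have hC₃C : C₃ ≤ C := ((le_max_right _ _).trans (le_max_right _ _)).trans (le_max_left _ _)
  have hC₄C : C₄ ≤ C := ((le_max_left _ _).trans (le_max_left _ _)).trans (le_max_right _ _)
  have hC₅C : C₅ ≤ C := ((le_max_right _ _).trans (le_max_left _ _)).trans (le_max_right _ _)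
  have hMx0 : 0 < max Mm Nx := lt_of_lt_of_le hM₀ hM0x
  refine ⟨max Mm Nx, δm, C, hMx0, hδm, zero_lt_one.trans_le hC1, fun i hM n J h y y' hcut hJ => ?_⟩
  -- the six files' thresholds from the one printed threshold `M₁ ≤ M = L·M_h`
  have hM' : max Mm Nx ≤ (((ℓ + 1 : ℕ) : ℝ)) * (i.Mh : ℝ) := hM
  have hcast : (((ℓ + 1 : ℕ) : ℝ)) = (ℓ : ℝ) + 1 := by push_cast; ring
  have hthrM : ∀ {M : ℝ}, M ≤ max Mm Nx → M ≤ ((ℓ : ℝ) + 1) * i.Mh := fun h => by rw [← hcast]; exact h.trans hM'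
  have hR1 : 1 ≤ i.R := le_trans (Nat.one_le_two_pow) (le_trans (Nat.pow_le_pow_left (by omega : 2 ≤ ℓ + 1) 2 |>.trans
    (Nat.le_mul_of_pos_left _ (by norm_num))) i.hR2)
  have hthrN : ∀ {N : ℕ}, ((N : ℝ) + 1) ≤ max Mm Nx → N + 1 ≤ i.R * ((ℓ + 1) * i.Mh) := by
    intro N h
    have h1 : ((N : ℝ) + 1) ≤ (((ℓ + 1 : ℕ) : ℝ)) * (i.Mh : ℝ) := h.trans hM'
    have h2 : N + 1 ≤ (ℓ + 1) * i.Mh := by exact_mod_cast h1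
    exact h2.trans (Nat.le_mul_of_pos_left _ hR1)
  have hM0i : M₀ ≤ ((ℓ : ℝ) + 1) * i.Mh := hthrM hM0x
  have hM1i : M₁' ≤ ((ℓ : ℝ) + 1) * i.Mh := hthrM hM1x
  have hM2i : M₂' ≤ ((ℓ : ℝ) + 1) * i.Mh := hthrM hM2x
  have hM3i : M₃' ≤ ((ℓ : ℝ) + 1) * i.Mh := hthrM hM3x
  have hM4i : M₄' ≤ ((ℓ : ℝ) + 1) * i.Mh := hthrM hM4x
  have hM5i : M₅' ≤ ((ℓ : ℝ) + 1) * i.Mh := hthrM hM5x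
  have hN1i : N₁ + 1 ≤ i.R * ((ℓ + 1) * i.Mh) := hthrN hN1x
  have hN2i : N₂ + 1 ≤ i.R * ((ℓ + 1) * i.Mh) := hthrN hN2x
  have hN3i : N₃ + 1 ≤ i.R * ((ℓ + 1) * i.Mh) := hthrN hN3x
  have hN4i : N₄ + 1 ≤ i.R * ((ℓ + 1) * i.Mh) := hthrN hN4x
  have hN5i : N₅ + 1 ≤ i.R * ((ℓ + 1) * i.Mh) := hthrN hN5x
  have hNri : 2 * (d + 1) * (ℓ + 1) + 1 ≤ i.R * ((ℓ + 1) * i.Mh) := hthrN hNrx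
  -- the six inputs at the index
  have hT0 := hF0 i.m i.K i.hN i.D i.hk i.hk2 i.hMha i.hM8 i.hR2 i.hP5 i.hℓ i.hpl hM0i i.hcf i.hw i.hwb
  have hT1 := hF1 i.m i.K i.hN i.D i.hk i.hk2 i.hMha i.hM8 i.hR2 i.hP5 i.hℓ i.hpl hM1i hN1i i.hcf i.hw i.hwb
  have hT2 := hF2 i.m i.K i.hN i.D i.hk i.hk2 i.hMha i.hM8 i.hR2 i.hP5 i.hℓ i.hpl hM2i hN2i i.hcf i.hw i.hwb
  have hT3 := hF3 i.m i.K i.hN i.D i.hk i.hk2 i.hMha i.hM8 i.hR2 i.hP5 i.hℓ i.hpl hM3i hN3i i.hcf i.hw i.hwb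
  have hT4 := hF4 i.m i.K i.hN i.D i.hk i.hk2 i.hMha i.hM8 i.hR2 i.hP5 i.hℓ i.hpl hM4i hN4i i.hcf i.hw i.hwb
  have hT5 := hF5 i.m i.K i.hN i.D i.hk i.hk2 i.hMha i.hM8 i.hR2 i.hP5 i.hℓ i.hpl hM5i hN5i i.hcf i.hw i.hwb
  clear hF0 hF1 hF2 hF3 hF4 hF5
  -- common comparisons
  have hd0 : 0 ≤ (geomT i.D).dist y y' := distT_nonneg y y'
  have hrate : ∀ {δ : ℝ}, δm ≤ δ → Real.exp (-(δ * (geomT i.D).dist y y')) ≤ Real.exp (-(δm * (geomT i.D).dist y y')) :=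
    fun h => Real.exp_le_exp.2 (neg_le_neg (mul_le_mul_of_nonneg_right h hd0))
  have hr0 := hrate hm0
  have hr1 := hrate hm1
  have hr2 := hrate hm2
  have hr3 := hrate hm3
  have hr4 := hrate hm4
  have hr5 := hrate hm5
  set s : ℝ := (kGeoG i).cutSup h with hs_def
  have hs0 : 0 ≤ s := supNormG_nonneg i h
  set Nm : ℝ := (kGeoG i).l2Norm J with hNm_def
  have hNm0 : 0 ≤ Nm := Real.sqrt_nonneg _
  have hlen : 0 < (kGeoG i).len y := lenG_pos i y
  have hEm0 : 0 ≤ Real.exp (-(δm * (geomT i.D).dist y y')) := (Real.exp_pos _).le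
  -- the printed prefactors
  have hp0 : B6.pref6 ((kGeoG i).len y) 0 = (kGeoG i).len y ^ 2 := rfl
  have hp1 : B6.pref6 ((kGeoG i).len y) 1 = (kGeoG i).len y ^ 1 := by rw [pow_one]; rfl
  have hp2 : B6.pref6 ((kGeoG i).len y) 2 = (kGeoG i).len y ^ 1 := by rw [pow_one]; rfl
  have hp3 : B6.pref6 ((kGeoG i).len y) 3 = (kGeoG i).len y ^ 0 := by rw [pow_zero]; rfl
  have hp4 : B6.pref6 ((kGeoG i).len y) 4 = (kGeoG i).len y ^ 0 := by rw [pow_zero]; rfl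
  have hp5 : B6.pref6 ((kGeoG i).len y) 5 = (kGeoG i).len y ^ 0 := by rw [pow_zero]; rfl
  fin_cases n
  · -- (2.140)₁  ‖hGJ‖ ≤ C·(Lʲη)²·|h|·e^{−δ₃d}·‖J‖
    show l2Of h (Gop i J) ≤ C * B6.pref6 ((kGeoG i).len y) 0 * s * Real.exp (-(δm * (geomT i.D).dist y y')) * Nm
    rw [hp0]
    have hT : ∀ (z y' : (geomT i.D).Site) (ζ J : PBond (PV d ℓ i.m i.K hd hL) 0 → ℝ) {s : ℝ},
        0 ≤ s → (∀ x, blkV1 i.hN i.D x ≠ z → ζ x = 0) → (∀ x, |ζ x| ≤ s) → (∀ x, blkV1 i.hN i.D x ≠ y' → J x = 0) →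
        ∑ x, (ζ x * (Gop i) J x) ^ 2 ≤
          (A₀ * ((geomT i.D).len z * |i.cf|⁻¹) ^ 2 * Real.exp (-(δ₀ * (geomT i.D).dist z y')) * s) ^ 2 * ∑ x, J x ^ 2 := by
      intro z y' ζ J s _ hζ hζs hJ
      have h := hT0 z y' ζ J hζ hζs hJ
      rw [pref_eq_lenG_sq i z, lenG_eq_geomT i z] at h
      exact h
    have hle := l2_entry_le i (T := fun J => Gop i J) hA₀ hδ₀.le hNri hT hcut hJ
    calc l2Of h (Gop i J) ≤ C₀ * (kGeoG i).len y ^ 2 * s * Real.exp (-(δ₀ * (geomT i.D).dist y y')) * Nm := hle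
      _ ≤ C * (kGeoG i).len y ^ 2 * s * Real.exp (-(δm * (geomT i.D).dist y y')) * Nm := by gcongr
  · -- (2.140)₂  ‖h∇_νGJ‖
    show (⨆ ν : Fin (d + 1), l2Of h ((DV ν i.cf ∘ₗ Gop i) J)) ≤
      C * B6.pref6 ((kGeoG i).len y) 1 * s * Real.exp (-(δm * (geomT i.D).dist y y')) * Nm
    rw [hp1]
    refine Real.iSup_le (fun ν => ?_) (by positivity)
    have hT : ∀ (z y' : (geomT i.D).Site) (ζ J : PBond (PV d ℓ i.m i.K hd hL) 0 → ℝ) {s : ℝ},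
        0 ≤ s → (∀ x, blkV1 i.hN i.D x ≠ z → ζ x = 0) → (∀ x, |ζ x| ≤ s) → (∀ x, blkV1 i.hN i.D x ≠ y' → J x = 0) →
        ∑ x, (ζ x * (DV ν i.cf ∘ₗ Gop i) J x) ^ 2 ≤
          (A₁ * ((geomT i.D).len z * |i.cf|⁻¹) ^ 1 * Real.exp (-(δ₁ * (geomT i.D).dist z y')) * s) ^ 2 * ∑ x, J x ^ 2 := by
      intro z y' ζ J s hs0' hζ hζs hJ
      rw [pow_one]
      exact hT1 ν z y' ζ J hs0' hζ hζs hJ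
    have hle := l2_entry_le i (T := fun J => (DV ν i.cf ∘ₗ Gop i) J) hA₁ hδ₁.le hNri hT hcut hJ
    calc l2Of h ((DV ν i.cf ∘ₗ Gop i) J) ≤ C₁ * (kGeoG i).len y ^ 1 * s * Real.exp (-(δ₁ * (geomT i.D).dist y y')) * Nm := hle
      _ ≤ C * (kGeoG i).len y ^ 1 * s * Real.exp (-(δm * (geomT i.D).dist y y')) * Nm := by gcongr
  · -- (2.140)₃  ‖hG∇*_νJ‖
    show (⨆ ν : Fin (d + 1), l2Of h ((Gop i ∘ₗ DVa ν i.cf) J)) ≤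
      C * B6.pref6 ((kGeoG i).len y) 2 * s * Real.exp (-(δm * (geomT i.D).dist y y')) * Nm
    rw [hp2]
    refine Real.iSup_le (fun ν => ?_) (by positivity)
    have hT : ∀ (z y' : (geomT i.D).Site) (ζ J : PBond (PV d ℓ i.m i.K hd hL) 0 → ℝ) {s : ℝ},
        0 ≤ s → (∀ x, blkV1 i.hN i.D x ≠ z → ζ x = 0) → (∀ x, |ζ x| ≤ s) → (∀ x, blkV1 i.hN i.D x ≠ y' → J x = 0) →
        ∑ x, (ζ x * (Gop i ∘ₗ DVa ν i.cf) J x) ^ 2 ≤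
          (A₂ * ((geomT i.D).len z * |i.cf|⁻¹) ^ 1 * Real.exp (-(δ₂ * (geomT i.D).dist z y')) * s) ^ 2 * ∑ x, J x ^ 2 := by
      intro z y' ζ J s hs0' hζ hζs hJ
      rw [pow_one]
      exact hT2 ν z y' ζ J hs0' hζ hζs hJ
    have hle := l2_entry_le i (T := fun J => (Gop i ∘ₗ DVa ν i.cf) J) hA₂ hδ₂.le hNri hT hcut hJ
    calc l2Of h ((Gop i ∘ₗ DVa ν i.cf) J) ≤ C₂ * (kGeoG i).len y ^ 1 * s * Real.exp (-(δ₂ * (geomT i.D).dist y y')) * Nm := hle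
      _ ≤ C * (kGeoG i).len y ^ 1 * s * Real.exp (-(δm * (geomT i.D).dist y y')) * Nm := by gcongr
  · -- (2.140)₄  ‖h∇_νG∇*_μJ‖
    show (⨆ ν : Fin (d + 1), ⨆ μ : Fin (d + 1), l2Of h ((DV ν i.cf ∘ₗ Gop i ∘ₗ DVa μ i.cf) J)) ≤
      C * B6.pref6 ((kGeoG i).len y) 3 * s * Real.exp (-(δm * (geomT i.D).dist y y')) * Nm
    rw [hp3]
    refine Real.iSup_le (fun ν => Real.iSup_le (fun μ => ?_) (by positivity)) (by positivity)
    have hT : ∀ (z y' : (geomT i.D).Site) (ζ J : PBond (PV d ℓ i.m i.K hd hL) 0 → ℝ) {s : ℝ},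
        0 ≤ s → (∀ x, blkV1 i.hN i.D x ≠ z → ζ x = 0) → (∀ x, |ζ x| ≤ s) → (∀ x, blkV1 i.hN i.D x ≠ y' → J x = 0) →
        ∑ x, (ζ x * (DV ν i.cf ∘ₗ Gop i ∘ₗ DVa μ i.cf) J x) ^ 2 ≤
          (A₃ * ((geomT i.D).len z * |i.cf|⁻¹) ^ 0 * Real.exp (-(δ₃' * (geomT i.D).dist z y')) * s) ^ 2 * ∑ x, J x ^ 2 := by
      intro z y' ζ J s hs0' hζ hζs hJ
      rw [pow_zero, mul_one]
      exact hT3 ν μ z y' ζ J hs0' hζ hζs hJ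
    have hle := l2_entry_le i (T := fun J => (DV ν i.cf ∘ₗ Gop i ∘ₗ DVa μ i.cf) J) hA₃ hδ₃'.le hNri hT hcut hJ
    calc l2Of h ((DV ν i.cf ∘ₗ Gop i ∘ₗ DVa μ i.cf) J) ≤ C₃ * (kGeoG i).len y ^ 0 * s * Real.exp (-(δ₃' * (geomT i.D).dist y y')) * Nm := hle
      _ ≤ C * (kGeoG i).len y ^ 0 * s * Real.exp (-(δm * (geomT i.D).dist y y')) * Nm := by gcongr
  · -- (2.140)₅  ‖h∇_ν∇_μGJ‖
    show (⨆ ν : Fin (d + 1), ⨆ μ : Fin (d + 1), l2Of h ((DV ν i.cf ∘ₗ DV μ i.cf ∘ₗ Gop i) J)) ≤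
      C * B6.pref6 ((kGeoG i).len y) 4 * s * Real.exp (-(δm * (geomT i.D).dist y y')) * Nm
    rw [hp4]
    refine Real.iSup_le (fun ν => Real.iSup_le (fun μ => ?_) (by positivity)) (by positivity)
    have hT : ∀ (z y' : (geomT i.D).Site) (ζ J : PBond (PV d ℓ i.m i.K hd hL) 0 → ℝ) {s : ℝ},
        0 ≤ s → (∀ x, blkV1 i.hN i.D x ≠ z → ζ x = 0) → (∀ x, |ζ x| ≤ s) → (∀ x, blkV1 i.hN i.D x ≠ y' → J x = 0) →
        ∑ x, (ζ x * (DV ν i.cf ∘ₗ DV μ i.cf ∘ₗ Gop i) J x) ^ 2 ≤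
          (A₄ * ((geomT i.D).len z * |i.cf|⁻¹) ^ 0 * Real.exp (-(δ₄ * (geomT i.D).dist z y')) * s) ^ 2 * ∑ x, J x ^ 2 := by
      intro z y' ζ J s hs0' hζ hζs hJ
      rw [pow_zero, mul_one]
      exact hT4 ν μ z y' ζ J hs0' hζ hζs hJ
    have hle := l2_entry_le i (T := fun J => (DV ν i.cf ∘ₗ DV μ i.cf ∘ₗ Gop i) J) hA₄ hδ₄.le hNri hT hcut hJ
    calc l2Of h ((DV ν i.cf ∘ₗ DV μ i.cf ∘ₗ Gop i) J) ≤ C₄ * (kGeoG i).len y ^ 0 * s * Real.exp (-(δ₄ * (geomT i.D).dist y y')) * Nm := hle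
      _ ≤ C * (kGeoG i).len y ^ 0 * s * Real.exp (-(δm * (geomT i.D).dist y y')) * Nm := by gcongr
  · -- (2.140)₆  ‖hG∇*_ν∇*_μJ‖
    show (⨆ ν : Fin (d + 1), ⨆ μ : Fin (d + 1), l2Of h ((Gop i ∘ₗ DVa ν i.cf ∘ₗ DVa μ i.cf) J)) ≤
      C * B6.pref6 ((kGeoG i).len y) 5 * s * Real.exp (-(δm * (geomT i.D).dist y y')) * Nm
    rw [hp5]
    refine Real.iSup_le (fun ν => Real.iSup_le (fun μ => ?_) (by positivity)) (by positivity)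
    have hT : ∀ (z y' : (geomT i.D).Site) (ζ J : PBond (PV d ℓ i.m i.K hd hL) 0 → ℝ) {s : ℝ},
        0 ≤ s → (∀ x, blkV1 i.hN i.D x ≠ z → ζ x = 0) → (∀ x, |ζ x| ≤ s) → (∀ x, blkV1 i.hN i.D x ≠ y' → J x = 0) →
        ∑ x, (ζ x * (Gop i ∘ₗ DVa ν i.cf ∘ₗ DVa μ i.cf) J x) ^ 2 ≤
          (A₅ * ((geomT i.D).len z * |i.cf|⁻¹) ^ 0 * Real.exp (-(δ₅ * (geomT i.D).dist z y')) * s) ^ 2 * ∑ x, J x ^ 2 := by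
      intro z y' ζ J s hs0' hζ hζs hJ
      rw [pow_zero, mul_one]
      exact hT5 ν μ z y' ζ J hs0' hζ hζs hJ
    have hle := l2_entry_le i (T := fun J => (Gop i ∘ₗ DVa ν i.cf ∘ₗ DVa μ i.cf) J) hA₅ hδ₅.le hNri hT hcut hJ
    calc l2Of h ((Gop i ∘ₗ DVa ν i.cf ∘ₗ DVa μ i.cf) J) ≤ C₅ * (kGeoG i).len y ^ 0 * s * Real.exp (-(δ₅ * (geomT i.D).dist y y')) * Nm := hle
      _ ≤ C * (kGeoG i).len y ^ 0 * s * Real.exp (-(δm * (geomT i.D).dist y y')) * Nm := by gcongr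

end Literature.MathematicalPhysics.QuantumFieldTheory.Balaban1983to89.B6Prop26Census2140KLevelV1

end
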